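import Literature.ModelTheory.ExponentialFields.SemialgebraicRichCuts
import HarnessLib

/-!
# Free pieces (capsule refinement subordinate to an open cover, IV)

Topic `Literature/ModelTheory/ExponentialFields` — block B2c₂ of the proof of the
`C¹`-triangulation theorem for compact semialgebraic sets
(`Literature.ModelTheory.ExponentialFields.OhmotoShiota2017_c1Triangulation`, statement of
[OhmotoShiota2017, Thm. 1.1]) along the proof of [Pawlucki2024], specialized to `p = 1`.

**Between Part I and Part II of the proof of [Pawlucki2024, Prop. 2.5]** (replacing the
disjoint refinement [Pawlucki2024, Cor. 2.4] in the rich-cut formulation).  Given the lenses of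
Part I — finitely many continuous pairs `bot ≤ top` (bottom lenses, pieces `(bot, top] ⊆ V`) and
`bot ≤ top` (top lenses, pieces `[bot, top) ⊆ V`) serving every nondegenerate fibre at its two
ends — sort all lens functions together with `a, b` into the laminar family `α₀ ≤ α₁ ≤ ⋯`
(`rcLaminar`, block B2a).  A nonempty piece `(α_k x, α_{k+1} x)` is **covered** when it lies in a
lens piece; the covered locus is clopen in the nondegenerate locus `N_k` (a rank argument for order
statistics), so its complement, the **free locus** `Free_k`, is open in `D`, the window
`[α_k, α_{k+1}]` pinches at `cl Free_k ∖ Free_k`, and over `Free_k` it stays away from the graphs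
of `a` and `b` (the corner intervals lie in the serving lenses).  These are exactly the "middle
capsules `L'`" of [Pawlucki2024, p. 3871, Part II], to which the thick-ladder construction
(block B2c₁) applies; the assembly lemma `rcValid_of_free` glues their cut families with the lens
functions into a family valid at every point.

No named facts are introduced (D-0026).

## References

* [Pawlucki2024] W. Pawłucki, *Strict `C^p`-triangulations — a new approach to
  desingularization*, J. Eur. Math. Soc. 26 (2024), 3863–3909, Prop. 2.5 (proof, Part II),
  Cor. 2.4.
* [OhmotoShiota2017] T. Ohmoto, M. Shiota, *`C¹`-triangulations of semialgebraic sets*,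
  J. Topology 10 (2017), Thm. 1.1 (statement only).
-/

noncomputable section

open Set Filter
open _root_.Topology

namespace Literature.ModelTheory.ExponentialFields

open Literature.NumberTheory.Transcendental (IsSemialgebraicFunOn IsSemialgebraicMapOn
  isSemialgebraicFunOn_iff)
open Literature.NumberTheory.Transcendental.SemialgebraicMonotonicity (sa_and sa_or sa_not sa_imp
  sa_lt sa_le sa_eq sa_const_lt sa_const_le)

/-! ### A rank lemma for order statistics -/

section Rank

variable {M : ℕ}

/-- No value lies strictly between two consecutive order statistics. [folklore] -/
theorem notMem_Ioo_sort (f : Fin M → ℝ) (i : Fin M) (k : Fin M) (k' : Fin M) (hk : (k' : ℕ) = k + 1) :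
    f i ∉ Ioo (f (Tuple.sort f k)) (f (Tuple.sort f k')) := by
  rintro ⟨h1, h2⟩
  set σ := Tuple.sort f
  have hmono := Tuple.monotone_sort f
  -- `i = σ j` for `j = σ⁻¹ i`
  have hi : f i = f (σ (σ.symm i)) := by simp
  rw [hi] at h1 h2
  have hjk : k < σ.symm i := by
    by_contra hle
    have h := hmono (not_lt.1 hle)
    simp only [Function.comp_apply] at h
    exact absurd h (not_le.2 h1)
  have hjk' : σ.symm i < k' := by
    by_contra hle
    have h := hmono (not_lt.1 hle)
    simp only [Function.comp_apply] at h
    exact absurd h (not_le.2 h2)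
  have h3 : (k : ℕ) < σ.symm i := hjk
  have h4 : ((σ.symm i : Fin M) : ℕ) < k' := hjk'
  omega

/-- If exactly the indices in `J` have values `≤ c` and all others have values `> c'` with `c < c'`...
The workhorse: if at least `k+1` values are `≤ v` and at most `k` values are `< v`, the `k`-th order
statistic is `v`. [folklore] -/
theorem sort_apply_eq_of_card (f : Fin M → ℝ) (k : Fin M) (v : ℝ)
    (h1 : (k : ℕ) + 1 ≤ (Finset.univ.filter fun i => f i ≤ v).card)
    (h2 : (Finset.univ.filter fun i => f i < v).card ≤ k) : f (Tuple.sort f k) = v :=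
  le_antisymm (sort_apply_le_of_card_le f k v h1) (le_sort_apply_of_card_le f k v h2)

variable {X : Type*} [TopologicalSpace X]

/-- **Rank lemma (lower side)**: if `g i x₀ ≤ α_k x₀ < α_{k+1} x₀` for the order statistics
`α` of a family of functions continuous within `S` at `x₀`, then `g i x ≤ α_k x` for `x ∈ S` near
`x₀`. [folklore] -/
theorem eventually_le_sort_apply {g : Fin M → X → ℝ} {S : Set X} {x₀ : X}
    (hg : ∀ i, ContinuousWithinAt (g i) S x₀) (k k' : Fin M) (hk : (k' : ℕ) = k + 1)
    (hgap : (fun i => g i x₀) (Tuple.sort (fun i => g i x₀) k) < (fun i => g i x₀) (Tuple.sort (fun i => g i x₀) k'))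
    {i : Fin M} (hi : g i x₀ ≤ (fun i => g i x₀) (Tuple.sort (fun i => g i x₀) k)) :
    ∀ᶠ x in 𝓝[S] x₀, g i x ≤ (fun i => g i x) (Tuple.sort (fun i => g i x) k) := by
  classical
  set f₀ : Fin M → ℝ := fun i => g i x₀ with hf₀
  set lo := f₀ (Tuple.sort f₀ k) with hlo
  set hi' := f₀ (Tuple.sort f₀ k') with hhi
  set mid := (lo + hi') / 2 with hmid
  have hlm : lo < mid := by rw [hmid]; linarith
  have hmh : mid < hi' := by rw [hmid]; linarith
  -- the set `J` of small indices
  set J : Finset (Fin M) := Finset.univ.filter fun j => f₀ j ≤ lo with hJ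
  have hJc : ∀ j, j ∉ J → hi' ≤ f₀ j := by
    intro j hj
    rw [hJ, Finset.mem_filter, not_and] at hj
    have hj' := not_le.1 (hj (Finset.mem_univ _))
    by_contra hlt
    exact notMem_Ioo_sort f₀ j k k' hk ⟨hj', not_le.1 hlt⟩
  have hcardJ : J.card = (k : ℕ) + 1 := by
    apply le_antisymm
    · -- `J` has at most `k+1` elements (else `α_{k'} ≤ lo`)
      by_contra hlt
      have hle : (k' : ℕ) + 1 ≤ J.card := by rw [hk]; omega
      have := sort_apply_le_of_card_le f₀ k' lo (by rw [hJ] at hle; exact hle)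
      exact absurd this (not_le.2 hgap)
    · -- the `k+1` smallest are in `J`
      have hsub : (Finset.Iic k).image (Tuple.sort f₀) ⊆ J := by
        intro j hj
        obtain ⟨l, hl, rfl⟩ := Finset.mem_image.1 hj
        rw [hJ, Finset.mem_filter]
        exact ⟨Finset.mem_univ _, Tuple.monotone_sort f₀ (Finset.mem_Iic.1 hl)⟩
      have h := Finset.card_le_card hsub
      rwa [Finset.card_image_of_injective _ (Tuple.sort f₀).injective, Fin.card_Iic] at h
  have hiJ : i ∈ J := by rw [hJ, Finset.mem_filter]; exact ⟨Finset.mem_univ _, hi⟩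
  -- near `x₀`: `J`-values `< mid`, other values `> mid`
  have hev : ∀ᶠ x in 𝓝[S] x₀, (∀ j ∈ J, g j x < mid) ∧ ∀ j, j ∉ J → mid < g j x := by
    have h1 : ∀ᶠ x in 𝓝[S] x₀, ∀ j ∈ J, g j x < mid := by
      refine (Finset.eventually_all J).2 fun j hj => ?_
      have hj' : g j x₀ < mid := by
        rw [hJ, Finset.mem_filter] at hj; exact lt_of_le_of_lt hj.2 hlm
      exact (hg j).eventually (gt_mem_nhds hj')
    have h2 : ∀ᶠ x in 𝓝[S] x₀, ∀ j, j ∉ J → mid < g j x := by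
      have : ∀ᶠ x in 𝓝[S] x₀, ∀ j ∈ Jᶜ, mid < g j x := by
        refine (Finset.eventually_all Jᶜ).2 fun j hj => ?_
        have hj' : mid < g j x₀ := lt_of_lt_of_le hmh (hJc j (Finset.mem_compl.1 hj))
        exact (hg j).eventually (lt_mem_nhds hj')
      exact this.mono fun x hx j hj => hx j (Finset.mem_compl.2 hj)
    exact h1.and h2
  filter_upwards [hev] with x hx
  obtain ⟨hxJ, hxJc⟩ := hx
  set f : Fin M → ℝ := fun j => g j x with hf
  -- `α_k x = max_{J} f`
  obtain ⟨j₀, hj₀J, hj₀max⟩ := Finset.exists_max_image J f ⟨i, hiJ⟩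
  have heq : f (Tuple.sort f k) = f j₀ := by
    apply sort_apply_eq_of_card
    · rw [← hcardJ]
      refine Finset.card_le_card fun j hj => ?_
      rw [Finset.mem_filter]
      exact ⟨Finset.mem_univ _, hj₀max j hj⟩
    · -- values `< f j₀` are in `J ∖ {j₀}`
      have hsub : (Finset.univ.filter fun j => f j < f j₀) ⊆ J.erase j₀ := by
        intro j hj
        rw [Finset.mem_filter] at hj
        rw [Finset.mem_erase]
        refine ⟨fun h => by rw [h] at hj; exact lt_irrefl _ hj.2, ?_⟩
        by_contra hjJ
        have h1 := hxJc j hjJ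
        have h2 := hxJ j₀ hj₀J
        linarith [hj.2]
      have h := Finset.card_le_card hsub
      rw [Finset.card_erase_of_mem hj₀J, hcardJ] at h
      simpa using h
  show g i x ≤ f (Tuple.sort f k)
  rw [heq]
  exact hj₀max i hiJ

/-- **Rank lemma (upper side)**: if `α_k x₀ < α_{k+1} x₀ ≤ g i x₀` then `α_{k+1} x ≤ g i x` for
`x ∈ S` near `x₀`. [folklore] -/
theorem eventually_sort_apply_le {g : Fin M → X → ℝ} {S : Set X} {x₀ : X}
    (hg : ∀ i, ContinuousWithinAt (g i) S x₀) (k k' : Fin M) (hk : (k' : ℕ) = k + 1)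
    (hgap : (fun i => g i x₀) (Tuple.sort (fun i => g i x₀) k) < (fun i => g i x₀) (Tuple.sort (fun i => g i x₀) k'))
    {i : Fin M} (hi : (fun i => g i x₀) (Tuple.sort (fun i => g i x₀) k') ≤ g i x₀) :
    ∀ᶠ x in 𝓝[S] x₀, (fun i => g i x) (Tuple.sort (fun i => g i x) k') ≤ g i x := by
  classical
  -- apply the lower-side lemma to `-g` with the reversed ranks
  set f₀ : Fin M → ℝ := fun i => g i x₀ with hf₀
  set lo := f₀ (Tuple.sort f₀ k) with hlo
  set hi' := f₀ (Tuple.sort f₀ k') with hhi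
  set mid := (lo + hi') / 2 with hmid
  have hlm : lo < mid := by rw [hmid]; linarith
  have hmh : mid < hi' := by rw [hmid]; linarith
  set J : Finset (Fin M) := Finset.univ.filter fun j => f₀ j ≤ lo with hJ
  have hJc : ∀ j, j ∉ J → hi' ≤ f₀ j := by
    intro j hj
    rw [hJ, Finset.mem_filter, not_and] at hj
    have hj' := not_le.1 (hj (Finset.mem_univ _))
    by_contra hlt
    exact notMem_Ioo_sort f₀ j k k' hk ⟨hj', not_le.1 hlt⟩
  have hcardJ : J.card = (k : ℕ) + 1 := by
    apply le_antisymm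
    · by_contra hlt
      have hle : (k' : ℕ) + 1 ≤ J.card := by rw [hk]; omega
      have := sort_apply_le_of_card_le f₀ k' lo (by rw [hJ] at hle; exact hle)
      exact absurd this (not_le.2 hgap)
    · have hsub : (Finset.Iic k).image (Tuple.sort f₀) ⊆ J := by
        intro j hj
        obtain ⟨l, hl, rfl⟩ := Finset.mem_image.1 hj
        rw [hJ, Finset.mem_filter]
        exact ⟨Finset.mem_univ _, Tuple.monotone_sort f₀ (Finset.mem_Iic.1 hl)⟩
      have h := Finset.card_le_card hsub
      rwa [Finset.card_image_of_injective _ (Tuple.sort f₀).injective, Fin.card_Iic] at h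
  have hiJ : i ∉ J := by
    rw [hJ, Finset.mem_filter, not_and]
    intro _ hle
    exact absurd (hi.trans hle) (not_le.2 hgap)
  have hev : ∀ᶠ x in 𝓝[S] x₀, (∀ j ∈ J, g j x < mid) ∧ ∀ j, j ∉ J → mid < g j x := by
    have h1 : ∀ᶠ x in 𝓝[S] x₀, ∀ j ∈ J, g j x < mid := by
      refine (Finset.eventually_all J).2 fun j hj => ?_
      have hj' : g j x₀ < mid := by
        rw [hJ, Finset.mem_filter] at hj; exact lt_of_le_of_lt hj.2 hlm
      exact (hg j).eventually (gt_mem_nhds hj')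
    have h2 : ∀ᶠ x in 𝓝[S] x₀, ∀ j, j ∉ J → mid < g j x := by
      have : ∀ᶠ x in 𝓝[S] x₀, ∀ j ∈ Jᶜ, mid < g j x := by
        refine (Finset.eventually_all Jᶜ).2 fun j hj => ?_
        have hj' : mid < g j x₀ := lt_of_lt_of_le hmh (hJc j (Finset.mem_compl.1 hj))
        exact (hg j).eventually (lt_mem_nhds hj')
      exact this.mono fun x hx j hj => hx j (Finset.mem_compl.2 hj)
    exact h1.and h2
  filter_upwards [hev] with x hx
  obtain ⟨hxJ, hxJc⟩ := hx
  set f : Fin M → ℝ := fun j => g j x with hf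
  -- `α_{k'} x = min_{Jᶜ} f`
  obtain ⟨j₀, hj₀J, hj₀min⟩ := Finset.exists_min_image Jᶜ f ⟨i, Finset.mem_compl.2 hiJ⟩
  have hj₀J' : j₀ ∉ J := Finset.mem_compl.1 hj₀J
  have heq : f (Tuple.sort f k') = f j₀ := by
    apply sort_apply_eq_of_card
    · -- `J ∪ {j₀}` have values `≤ f j₀`
      have hsub : insert j₀ J ⊆ Finset.univ.filter fun j => f j ≤ f j₀ := by
        intro j hj
        rw [Finset.mem_filter]
        refine ⟨Finset.mem_univ _, ?_⟩
        rcases Finset.mem_insert.1 hj with rfl | hj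
        · exact le_rfl
        · have h1 := hxJ j hj
          have h2 := hxJc j₀ hj₀J'
          linarith
      have h := Finset.card_le_card hsub
      rw [Finset.card_insert_of_notMem hj₀J', hcardJ] at h
      rw [hk]; exact h
    · -- values `< f j₀` are in `J`
      have hsub : (Finset.univ.filter fun j => f j < f j₀) ⊆ J := by
        intro j hj
        rw [Finset.mem_filter] at hj
        by_contra hjJ
        exact absurd (hj₀min j (Finset.mem_compl.2 hjJ)) (not_le.2 hj.2)
      have h := Finset.card_le_card hsub
      rw [hcardJ] at h
      rw [hk]; exact h
  show f (Tuple.sort f k') ≤ g i x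
  rw [heq]
  exact hj₀min i (Finset.mem_compl.2 hiJ)

end Rank

/-! ### Lens families and the laminar family -/

section Free

variable {m q : ℕ}

/-- The output of Part I: the base `D`, the capsule `[a, b]`, the cover, and the bottom and top
lens families with their cover indices. [cite: Pawlucki2024, Prop. 2.5 (proof, Parts I–II)] -/
structure LensFamilies (m q : ℕ) where
  /-- the base -/
  D : Set (Fin m → ℝ)
  /-- bottom of the capsule -/
  a : (Fin m → ℝ) → ℝ
  /-- top of the capsule -/
  b : (Fin m → ℝ) → ℝ
  /-- the cover -/
  V : Fin q → Set (Fin (m + 1) → ℝ)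
  /-- number of bottom lenses -/
  Ib : ℕ
  /-- bottom lenses: bottoms -/
  bm : Fin Ib → (Fin m → ℝ) → ℝ
  /-- bottom lenses: tops -/
  bp : Fin Ib → (Fin m → ℝ) → ℝ
  /-- bottom lenses: cover indices -/
  jbI : Fin Ib → Fin q
  /-- number of top lenses -/
  It : ℕ
  /-- top lenses: bottoms -/
  tm : Fin It → (Fin m → ℝ) → ℝ
  /-- top lenses: tops -/
  tp : Fin It → (Fin m → ℝ) → ℝ
  /-- top lenses: cover indices -/
  jtI : Fin It → Fin q

/-- Hypotheses on lens families (topological layer). [cite: Pawlucki2024, Prop. 2.5 (proof, Part I)] -/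
structure LensFamilies.Hyp (F : LensFamilies m q) : Prop where
  D_closed : IsClosed F.D
  a_cont : Continuous F.a
  b_cont : Continuous F.b
  a_le_b : ∀ x ∈ F.D, F.a x ≤ F.b x
  bm_cont : ∀ i, Continuous (F.bm i)
  bp_cont : ∀ i, Continuous (F.bp i)
  tm_cont : ∀ i, Continuous (F.tm i)
  tp_cont : ∀ i, Continuous (F.tp i)
  L1b : ∀ i x t, F.bm i x < t → t ≤ F.bp i x → (Fin.snoc x t : Fin (m + 1) → ℝ) ∈ F.V (F.jbI i)
  L1t : ∀ i x t, F.tm i x ≤ t → t < F.tp i x → (Fin.snoc x t : Fin (m + 1) → ℝ) ∈ F.V (F.jtI i)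
  L2b : ∀ x ∈ F.D, F.a x < F.b x → ∃ i, F.bm i x = F.a x ∧ F.a x < F.bp i x
  L2t : ∀ x ∈ F.D, F.a x < F.b x → ∃ i, F.tp i x = F.b x ∧ F.tm i x < F.b x
  cover : ∀ x ∈ F.D, ∀ t ∈ Ioo (F.a x) (F.b x), ∃ j, (Fin.snoc x t : Fin (m + 1) → ℝ) ∈ F.V j

namespace LensFamilies

variable (F : LensFamilies m q)

/-- Number of lens functions. [cite: Pawlucki2024, Prop. 2.5] -/
def N : ℕ := F.Ib + F.Ib + (F.It + F.It)

/-- The enumeration of all lens functions. [cite: Pawlucki2024, Prop. 2.5] -/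
def cuts : Fin F.N → (Fin m → ℝ) → ℝ := Fin.append (Fin.append F.bm F.bp) (Fin.append F.tm F.tp)

/-- The laminar family `α_k` (sorted `a`, `b` and clamped lens functions). [cite: Pawlucki2024, Cor. 2.4] -/
def α (k : ℕ) : (Fin m → ℝ) → ℝ := rcLaminar F.a F.b F.cuts k

/-- The piece `(α_k, α_{k+1})` over `x` is **covered** by a lens. [cite: Pawlucki2024, p. 3871] -/
def Covered (k : ℕ) (x : Fin m → ℝ) : Prop :=
  (∃ i, F.bm i x ≤ F.α k x ∧ F.α (k + 1) x ≤ F.bp i x) ∨ (∃ i, F.tm i x ≤ F.α k x ∧ F.α (k + 1) x ≤ F.tp i x)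

/-- **The free locus** of the `k`-th piece. [cite: Pawlucki2024, p. 3871, the capsules `L'`] -/
def Free (k : ℕ) : Set (Fin m → ℝ) := {x | x ∈ F.D ∧ F.α k x < F.α (k + 1) x ∧ ¬ F.Covered k x}

/-- Bottom-lens bottoms are cuts. [cite: Pawlucki2024, Prop. 2.5] -/
theorem cuts_bm (i : Fin F.Ib) : F.cuts (Fin.castAdd _ (Fin.castAdd _ i)) = F.bm i := by
  unfold cuts; rw [Fin.append_left, Fin.append_left]

/-- Bottom-lens tops are cuts. [cite: Pawlucki2024, Prop. 2.5] -/
theorem cuts_bp (i : Fin F.Ib) : F.cuts (Fin.castAdd _ (Fin.natAdd _ i)) = F.bp i := by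
  unfold cuts; rw [Fin.append_left, Fin.append_right]

/-- Top-lens bottoms are cuts. [cite: Pawlucki2024, Prop. 2.5] -/
theorem cuts_tm (i : Fin F.It) : F.cuts (Fin.natAdd _ (Fin.castAdd _ i)) = F.tm i := by
  unfold cuts; rw [Fin.append_right, Fin.append_left]

/-- Top-lens tops are cuts. [cite: Pawlucki2024, Prop. 2.5] -/
theorem cuts_tp (i : Fin F.It) : F.cuts (Fin.natAdd _ (Fin.natAdd _ i)) = F.tp i := by
  unfold cuts; rw [Fin.append_right, Fin.append_right]

variable {F} (H : F.Hyp)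
include H

/-- `α` is monotone in the index. [cite: Pawlucki2024, Cor. 2.4] -/
theorem α_mono {x : Fin m → ℝ} (hx : x ∈ F.D) : Monotone fun k => F.α k x := rcLaminar_mono (H.a_le_b x hx)

/-- `α 0 = a`. [cite: Pawlucki2024, Cor. 2.4] -/
theorem α_zero {x : Fin m → ℝ} (hx : x ∈ F.D) : F.α 0 x = F.a x := rcLaminar_zero (H.a_le_b x hx)

/-- `α (N+1) = b` (and beyond). [cite: Pawlucki2024, Cor. 2.4] -/
theorem α_last {x : Fin m → ℝ} (hx : x ∈ F.D) {k : ℕ} (hk : F.N + 1 ≤ k) : F.α k x = F.b x := by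
  rcases eq_or_lt_of_le hk with rfl | hlt
  · exact rcLaminar_last (H.a_le_b x hx)
  · unfold α rcLaminar; rw [dif_neg (by omega)]

/-- `α k ∈ [a, b]`. [cite: Pawlucki2024, Cor. 2.4] -/
theorem α_mem {x : Fin m → ℝ} (hx : x ∈ F.D) (k : ℕ) : F.α k x ∈ Icc (F.a x) (F.b x) := by
  have hm := α_mono H hx
  constructor
  · rw [← α_zero H hx]; exact hm (Nat.zero_le k)
  · rw [← α_last H hx (le_max_right k (F.N + 1))]; exact hm (le_max_left _ _)

/-- `α k` is continuous on `D`. [cite: Pawlucki2024, Cor. 2.4] -/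
theorem continuousOn_α (k : ℕ) : ContinuousOn (F.α k) F.D := by
  have hc : ∀ i, ContinuousOn (F.cuts i) F.D := by
    intro i
    refine Fin.addCases (fun i => ?_) (fun i => ?_) i
    · refine Fin.addCases (fun i => ?_) (fun i => ?_) i
      · simp only [cuts, Fin.append_left]; exact (H.bm_cont i).continuousOn
      · simp only [cuts, Fin.append_left, Fin.append_right]; exact (H.bp_cont i).continuousOn
    · refine Fin.addCases (fun i => ?_) (fun i => ?_) i
      · simp only [cuts, Fin.append_right, Fin.append_left]; exact (H.tm_cont i).continuousOn
      · simp only [cuts, Fin.append_right]; exact (H.tp_cont i).continuousOn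
  exact continuousOn_rcLaminar H.a_cont.continuousOn H.b_cont.continuousOn hc k

/-! #### Covered pieces are good -/

omit H in
/-- A covered piece is good. [cite: Pawlucki2024, p. 3871] -/
theorem rcGood_of_covered (H : F.Hyp) {k : ℕ} {x : Fin m → ℝ} (h : F.Covered k x) :
    RCGood F.V x (F.α k x) (F.α (k + 1) x) := by
  rcases h with ⟨i, h1, h2⟩ | ⟨i, h1, h2⟩
  · exact ⟨F.jbI i, fun t ht => H.L1b i x t (h1.trans_lt ht.1) (ht.2.le.trans h2)⟩
  · exact ⟨F.jtI i, fun t ht => H.L1t i x t (h1.trans ht.1.le) (ht.2.trans_le h2)⟩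

/-! #### The covered locus is open in the nondegenerate locus (rank lemma) -/

omit H in
/-- The family values as functions, for the rank lemma. [cite: Pawlucki2024, Cor. 2.4] -/
theorem α_eq_sort {k : ℕ} (hk : k < F.N + 2) (x : Fin m → ℝ) :
    F.α k x = (fun i => rcFamily F.a F.b F.cuts i x) (Tuple.sort (fun i => rcFamily F.a F.b F.cuts i x) ⟨k, hk⟩) := by
  unfold α rcLaminar
  rw [dif_pos hk]

/-- Continuity within `D` of the family members. [cite: Pawlucki2024, Cor. 2.4] -/
theorem continuousWithinAt_rcFamily (x₀ : Fin m → ℝ) (i : Fin (F.N + 2)) :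
    ContinuousWithinAt (rcFamily F.a F.b F.cuts i) F.D x₀ := by
  refine Fin.cases ?_ (fun i => Fin.cases ?_ (fun i => ?_) i) i
  · exact H.a_cont.continuousWithinAt
  · exact H.b_cont.continuousWithinAt
  · simp only [rcFamily, Fin.cons_succ]
    unfold rcClampFun
    have hc : Continuous (F.cuts i) := by
      refine Fin.addCases (fun i => ?_) (fun i => ?_) i
      · refine Fin.addCases (fun i => ?_) (fun i => ?_) i
        · simp only [cuts, Fin.append_left]; exact H.bm_cont i
        · simp only [cuts, Fin.append_left, Fin.append_right]; exact H.bp_cont i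
      · refine Fin.addCases (fun i => ?_) (fun i => ?_) i
        · simp only [cuts, Fin.append_right, Fin.append_left]; exact H.tm_cont i
        · simp only [cuts, Fin.append_right]; exact H.tp_cont i
    exact (H.a_cont.max (hc.min H.b_cont)).continuousWithinAt

/-- The gap forces `k + 1 < N + 2`. [cite: Pawlucki2024, Cor. 2.4] -/
theorem lt_of_gap {k : ℕ} {x : Fin m → ℝ} (hx : x ∈ F.D) (hgap : F.α k x < F.α (k + 1) x) : k + 1 < F.N + 2 := by
  by_contra hge
  have h1 : F.α (k + 1) x = F.b x := α_last H hx (by omega)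
  have h2 : F.b x ≤ F.α k x := by
    rcases Nat.lt_or_ge k (F.N + 1) with h | h
    · omega
    · rw [α_last H hx h]
  rw [h1] at hgap
  exact absurd hgap (not_lt.2 h2)

/-- **Lower persistence**: a lens function below `α_k x₀` (with a gap above) stays below `α_k` on `D`
near `x₀`, as long as the gap persists. [cite: Pawlucki2024, Cor. 2.4] -/
theorem eventually_cut_le_α {k : ℕ} {x₀ : Fin m → ℝ} (hx₀ : x₀ ∈ F.D) (hgap : F.α k x₀ < F.α (k + 1) x₀)
    (j : Fin F.N) (hj : F.cuts j x₀ ≤ F.α k x₀) :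
    ∀ᶠ x in 𝓝[F.D] x₀, x ∈ F.D → F.α k x < F.α (k + 1) x → F.cuts j x ≤ F.α k x := by
  have hk1 := lt_of_gap H hx₀ hgap
  have hk : k < F.N + 2 := by omega
  -- the family member `clamp (cuts j)` is `≤ α_k x₀`
  have hαb : F.α k x₀ < F.b x₀ := hgap.trans_le (α_mem H hx₀ (k + 1)).2
  have hfam : rcFamily F.a F.b F.cuts j.succ.succ x₀ ≤ F.α k x₀ := by
    simp only [rcFamily, Fin.cons_succ, rcClampFun]
    refine max_le (α_mem H hx₀ k).1 ((min_le_left _ _).trans hj)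
  have hev := eventually_le_sort_apply (S := F.D) (g := fun i x => rcFamily F.a F.b F.cuts i x)
    (fun i => continuousWithinAt_rcFamily H x₀ i) ⟨k, hk⟩ ⟨k + 1, hk1⟩ rfl
    (by rw [← α_eq_sort hk, ← α_eq_sort hk1]; exact hgap) (i := j.succ.succ) (by rw [← α_eq_sort hk]; exact hfam)
  filter_upwards [hev] with x hx' hxD hgapx
  have hx : rcFamily F.a F.b F.cuts j.succ.succ x ≤ F.α k x := by rw [α_eq_sort hk x]; exact hx'
  simp only [rcFamily, Fin.cons_succ, rcClampFun] at hx
  -- from `max (a x) (min (cuts j x) (b x)) ≤ α k x` deduce `cuts j x ≤ α k x`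
  have hαb' : F.α k x < F.b x := hgapx.trans_le (α_mem H hxD (k + 1)).2
  by_contra hlt
  have hlt' := not_le.1 hlt
  have : min (F.cuts j x) (F.b x) ≤ F.α k x := (le_max_right _ _).trans hx
  rcases le_total (F.cuts j x) (F.b x) with h | h
  · rw [min_eq_left h] at this; exact absurd this (not_le.2 hlt')
  · rw [min_eq_right h] at this; exact absurd this (not_le.2 hαb')

/-- **Upper persistence**: a lens function above `α_{k+1} x₀` stays above `α_{k+1}` on `D` near `x₀`.
[cite: Pawlucki2024, Cor. 2.4] -/
theorem eventually_α_le_cut {k : ℕ} {x₀ : Fin m → ℝ} (hx₀ : x₀ ∈ F.D) (hgap : F.α k x₀ < F.α (k + 1) x₀)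
    (j : Fin F.N) (hj : F.α (k + 1) x₀ ≤ F.cuts j x₀) :
    ∀ᶠ x in 𝓝[F.D] x₀, x ∈ F.D → F.α k x < F.α (k + 1) x → F.α (k + 1) x ≤ F.cuts j x := by
  have hk1 := lt_of_gap H hx₀ hgap
  have hk : k < F.N + 2 := by omega
  have haα : F.a x₀ < F.α (k + 1) x₀ := (α_mem H hx₀ k).1.trans_lt hgap
  have hfam : F.α (k + 1) x₀ ≤ rcFamily F.a F.b F.cuts j.succ.succ x₀ := by
    simp only [rcFamily, Fin.cons_succ, rcClampFun]
    exact le_max_of_le_right (le_min hj (α_mem H hx₀ (k + 1)).2)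
  have hev := eventually_sort_apply_le (S := F.D) (g := fun i x => rcFamily F.a F.b F.cuts i x)
    (fun i => continuousWithinAt_rcFamily H x₀ i) ⟨k, hk⟩ ⟨k + 1, hk1⟩ rfl
    (by rw [← α_eq_sort hk, ← α_eq_sort hk1]; exact hgap) (i := j.succ.succ) (by rw [← α_eq_sort hk1]; exact hfam)
  filter_upwards [hev] with x hx' hxD hgapx
  have hx : F.α (k + 1) x ≤ rcFamily F.a F.b F.cuts j.succ.succ x := by rw [α_eq_sort hk1 x]; exact hx'
  simp only [rcFamily, Fin.cons_succ, rcClampFun] at hx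
  have haα' : F.a x < F.α (k + 1) x := (α_mem H hxD k).1.trans_lt hgapx
  rcases le_total (F.a x) (min (F.cuts j x) (F.b x)) with h | h
  · rw [max_eq_right h] at hx; exact hx.trans (min_le_left _ _)
  · rw [max_eq_left h] at hx; exact absurd hx (not_le.2 haα')

/-- **The covered locus is open in the nondegenerate locus.** [cite: Pawlucki2024, p. 3871] -/
theorem eventually_covered {k : ℕ} {x₀ : Fin m → ℝ} (hx₀ : x₀ ∈ F.D) (hgap : F.α k x₀ < F.α (k + 1) x₀)
    (hcov : F.Covered k x₀) :
    ∀ᶠ x in 𝓝[F.D] x₀, x ∈ F.D → F.α k x < F.α (k + 1) x → F.Covered k x := by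
  rcases hcov with ⟨i, h1, h2⟩ | ⟨i, h1, h2⟩
  · have e1 := cuts_bm F i
    have e2 := cuts_bp F i
    have ev1 := eventually_cut_le_α H hx₀ hgap (Fin.castAdd _ (Fin.castAdd _ i)) (by rw [e1]; exact h1)
    have ev2 := eventually_α_le_cut H hx₀ hgap (Fin.castAdd _ (Fin.natAdd _ i)) (by rw [e2]; exact h2)
    filter_upwards [ev1, ev2] with x hx1 hx2 hxD hgapx
    refine Or.inl ⟨i, ?_, ?_⟩
    · rw [← e1]; exact hx1 hxD hgapx
    · rw [← e2]; exact hx2 hxD hgapx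
  · have e1 := cuts_tm F i
    have e2 := cuts_tp F i
    have ev1 := eventually_cut_le_α H hx₀ hgap (Fin.natAdd _ (Fin.castAdd _ i)) (by rw [e1]; exact h1)
    have ev2 := eventually_α_le_cut H hx₀ hgap (Fin.natAdd _ (Fin.natAdd _ i)) (by rw [e2]; exact h2)
    filter_upwards [ev1, ev2] with x hx1 hx2 hxD hgapx
    refine Or.inr ⟨i, ?_, ?_⟩
    · rw [← e1]; exact hx1 hxD hgapx
    · rw [← e2]; exact hx2 hxD hgapx

/-! #### Free pieces stay away from the corners -/

/-- No family value lies strictly between `α_k x` and `α_{k+1} x`. [cite: Pawlucki2024, Cor. 2.4] -/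
theorem cuts_clamp_notMem_Ioo {x : Fin m → ℝ} (hx : x ∈ F.D) (k : ℕ) (j : Fin F.N) :
    max (F.a x) (min (F.cuts j x) (F.b x)) ∉ Ioo (F.α k x) (F.α (k + 1) x) := by
  have h := rcFamily_notMem_Ioo (a := F.a) (b := F.b) (c := F.cuts) (H.a_le_b x hx) k j.succ.succ (x := x)
  simp only [rcFamily, Fin.cons_succ, rcClampFun] at h
  exact h

/-- **Over the free locus the window stays above `a`.** [cite: Pawlucki2024, p. 3871] -/
theorem a_lt_α_of_free {k : ℕ} {x : Fin m → ℝ} (hx : x ∈ F.Free k) : F.a x < F.α k x := by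
  obtain ⟨hxD, hgap, hnc⟩ := hx
  have hab : F.a x < F.b x := (α_mem H hxD k).1.trans_lt (hgap.trans_le (α_mem H hxD (k + 1)).2)
  rcases eq_or_lt_of_le (α_mem H hxD k).1 with heq | hlt
  · exfalso
    obtain ⟨i, hi1, hi2⟩ := H.L2b x hxD hab
    apply hnc
    refine Or.inl ⟨i, by rw [hi1, heq], ?_⟩
    -- the family value of `bp i` is `> a x = α k x`, hence `≥ α (k+1) x`
    have hval := cuts_clamp_notMem_Ioo H hxD k (Fin.castAdd _ (Fin.natAdd _ i))
    rw [cuts_bp] at hval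
    have hgt : F.α k x < max (F.a x) (min (F.bp i x) (F.b x)) := by
      rw [← heq]; exact lt_max_of_lt_right (lt_min hi2 hab)
    rw [mem_Ioo, not_and, not_lt] at hval
    exact (hval hgt).trans ((max_le hi2.le (min_le_left _ _)))
  · exact hlt

/-- **Over the free locus the window stays below `b`.** [cite: Pawlucki2024, p. 3871] -/
theorem α_lt_b_of_free {k : ℕ} {x : Fin m → ℝ} (hx : x ∈ F.Free k) : F.α (k + 1) x < F.b x := by
  obtain ⟨hxD, hgap, hnc⟩ := hx
  have hab : F.a x < F.b x := (α_mem H hxD k).1.trans_lt (hgap.trans_le (α_mem H hxD (k + 1)).2)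
  rcases eq_or_lt_of_le (α_mem H hxD (k + 1)).2 with heq | hlt
  · exfalso
    obtain ⟨i, hi1, hi2⟩ := H.L2t x hxD hab
    apply hnc
    refine Or.inr ⟨i, ?_, by rw [hi1, heq]⟩
    have hval := cuts_clamp_notMem_Ioo H hxD k (Fin.natAdd _ (Fin.castAdd _ i))
    rw [cuts_tm] at hval
    have hlt' : max (F.a x) (min (F.tm i x) (F.b x)) < F.α (k + 1) x := by
      rw [heq]; exact max_lt hab (min_lt_of_left_lt hi2)
    rw [mem_Ioo, not_and', not_lt] at hval
    have h := hval hlt'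
    rw [min_eq_left hi2.le] at h
    exact (le_max_right _ _).trans h
  · exact hlt

/-- **The closed fibres of a free window are covered.** [cite: Pawlucki2024, p. 3871] -/
theorem exists_mem_V_of_free {k : ℕ} {x : Fin m → ℝ} (hx : x ∈ F.Free k) {t : ℝ}
    (ht : t ∈ Icc (F.α k x) (F.α (k + 1) x)) : ∃ j, (Fin.snoc x t : Fin (m + 1) → ℝ) ∈ F.V j :=
  H.cover x hx.1 t ⟨(a_lt_α_of_free H hx).trans_le ht.1, ht.2.trans_lt (α_lt_b_of_free H hx)⟩

/-! #### The rim of a free piece pinches -/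

omit H in
/-- The free locus lies in `D`. [cite: Pawlucki2024, p. 3871] -/
theorem free_subset (k : ℕ) : F.Free k ⊆ F.D := fun _ hx => hx.1

/-- **The window pinches at the rim of the free locus**: `α_k = α_{k+1}` on `cl Free_k ∖ Free_k`.
[cite: Pawlucki2024, p. 3871, `γ = δ` on `∂Q`] -/
theorem α_eq_of_mem_closure_free {k : ℕ} {z : Fin m → ℝ} (hz : z ∈ closure (F.Free k)) (hnz : z ∉ F.Free k) :
    F.α k z = F.α (k + 1) z := by
  have hzD : z ∈ F.D := closure_minimal (free_subset (F := F) k) H.D_closed hz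
  by_contra hne
  have hgap : F.α k z < F.α (k + 1) z := lt_of_le_of_ne (α_mono H hzD (Nat.le_succ k)) hne
  have hcov : F.Covered k z := by
    by_contra hnc; exact hnz ⟨hzD, hgap, hnc⟩
  have hev := eventually_covered H hzD hgap hcov
  -- along `Free k` (a subset of `D`) we get a contradiction
  haveI : (𝓝[F.Free k] z).NeBot := mem_closure_iff_nhdsWithin_neBot.1 hz
  have h1 : ∀ᶠ x in 𝓝[F.Free k] z, x ∈ F.D → F.α k x < F.α (k + 1) x → F.Covered k x :=
    hev.filter_mono (nhdsWithin_mono z (free_subset (F := F) k))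
  have h2 : ∀ᶠ x in 𝓝[F.Free k] z, x ∈ F.Free k := self_mem_nhdsWithin
  have h3 : ∀ᶠ x in 𝓝[F.Free k] z, False := by
    filter_upwards [h1, h2] with x hx1 hx2
    exact hx2.2.2 (hx1 hx2.1 hx2.2.1)
  exact h3.exists.elim fun _ h => h

/-! #### Assembly: validity from validity on the free windows -/

omit H in
/-- Family values avoiding `(u, v)`: if no member of `𝒞 ⊇ cuts` has a value in `(u, v) ⊆ (a x, b x)`
then no clamped family value lies in `(u, v)`. [cite: Pawlucki2024, Prop. 2.5] -/
theorem rcFamily_notMem_Ioo_of_cons {𝒞 : Finset ((Fin m → ℝ) → ℝ)} (hcuts : ∀ j, F.cuts j ∈ 𝒞)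
    {x : Fin m → ℝ} {u v : ℝ} (hu : F.a x ≤ u) (hv : v ≤ F.b x)
    (hcons : ∀ w ∈ rcCutVals F.a F.b 𝒞 x, w ≤ u ∨ v ≤ w) (i : Fin (F.N + 2)) :
    rcFamily F.a F.b F.cuts i x ∉ Ioo u v := by
  rintro ⟨h1, h2⟩
  revert h1 h2
  refine Fin.cases ?_ (fun i => Fin.cases ?_ (fun j => ?_) i) i
  · intro h1 _; exact absurd (hu.trans_lt h1) (lt_irrefl _)
  · intro _ h2; exact absurd (h2.trans_le hv) (lt_irrefl _)
  · intro h1 h2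
    simp only [rcFamily, Fin.cons_succ, rcClampFun] at h1 h2
    have ha : F.a x < F.cuts j x := by
      by_contra hle
      rw [min_eq_left ((not_lt.1 hle).trans (hu.trans (h1.le.trans (h2.le.trans hv)))), max_eq_left (not_lt.1 hle)] at h1
      exact absurd (hu.trans_lt h1) (lt_irrefl _)
    have hb : F.cuts j x < F.b x := by
      by_contra hle
      rw [min_eq_right (not_lt.1 hle)] at h2
      exact absurd ((le_max_right _ _).trans_lt h2 |>.trans_le hv) (lt_irrefl _)
    have heq : max (F.a x) (min (F.cuts j x) (F.b x)) = F.cuts j x := by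
      rw [min_eq_left hb.le, max_eq_right ha.le]
    rw [heq] at h1 h2
    rcases hcons _ (mem_rcCutVals_of_mem (hcuts j) ha hb) with h | h
    · exact absurd h1 (not_lt.2 h)
    · exact absurd h2 (not_lt.2 h)

/-- **Assembly** [Pawlucki2024, Prop. 2.5, end of proof]: a cut family containing all lens functions
and valid on every free window `(α_k, α_{k+1})` over its free locus is valid on the whole capsule
`(a, b)` at every point of `D`. [cite: Pawlucki2024, Prop. 2.5 (proof, Part II)] -/
theorem rcValid_of_free (𝒞 : Finset ((Fin m → ℝ) → ℝ)) (hcuts : ∀ j, F.cuts j ∈ 𝒞)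
    (hfree : ∀ k ≤ F.N, ∀ x ∈ F.Free k, RCValid (F.α k) (F.α (k + 1)) F.V 𝒞 x) {x : Fin m → ℝ}
    (hx : x ∈ F.D) : RCValid F.a F.b F.V 𝒞 x := by
  classical
  refine rcValid_of_forall fun u v hu hv hlt hcons => ?_
  -- all `α k x` avoid `(u, v)`
  have havoid : ∀ k, F.α k x ≤ u ∨ v ≤ F.α k x := by
    intro k
    by_cases hk : k < F.N + 2
    · obtain ⟨i, hi⟩ := exists_rcLaminar_eq (a := F.a) (b := F.b) (c := F.cuts) (x := x) hk
      have h := rcFamily_notMem_Ioo_of_cons hcuts hu hv hcons i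
      rw [← hi] at h
      rw [mem_Ioo, not_and_or, not_lt, not_lt] at h
      exact h
    · right
      have : F.α k x = F.b x := α_last H hx (by omega)
      rw [this]; exact hv
  -- the largest `k ≤ N + 1` with `α k x ≤ u`
  set k₀ := Nat.findGreatest (fun k => F.α k x ≤ u) (F.N + 1) with hk₀
  have hk₀le : k₀ ≤ F.N + 1 := Nat.findGreatest_le _
  have h0 : F.α 0 x ≤ u := by rw [α_zero H hx]; exact hu
  have hPk₀ : F.α k₀ x ≤ u := Nat.findGreatest_spec (P := fun k => F.α k x ≤ u) (m := 0) (Nat.zero_le _) h0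
  have hk₀N : k₀ ≤ F.N := by
    by_contra hgt
    have heq : k₀ = F.N + 1 := by omega
    have : F.α k₀ x = F.b x := α_last H hx (by omega)
    rw [this] at hPk₀
    exact absurd (hlt.trans_le hv) (not_lt.2 hPk₀)
  have hnext : v ≤ F.α (k₀ + 1) x := by
    rcases havoid (k₀ + 1) with h | h
    · exact absurd h (Nat.findGreatest_is_greatest (Nat.lt_succ_self k₀) (by omega))
    · exact h
  have hgap : F.α k₀ x < F.α (k₀ + 1) x := hPk₀.trans_lt (hlt.trans_le hnext)
  by_cases hcov : F.Covered k₀ x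
  · exact (rcGood_of_covered H hcov).mono hPk₀ hnext
  · have hfx : x ∈ F.Free k₀ := ⟨hx, hgap, hcov⟩
    refine (hfree k₀ hk₀N x hfx).rcGood hPk₀ hnext hlt fun w hw => ?_
    rcases hw with rfl | rfl | ⟨c, hc, rfl, h1, h2⟩
    · exact Or.inl hPk₀
    · exact Or.inr hnext
    · exact hcons _ (mem_rcCutVals_of_mem hc ((α_mem H hx k₀).1.trans_lt h1) (h2.trans_le (α_mem H hx _).2))

/-! #### Semialgebraicity -/

/-- Semialgebraicity hypotheses on lens families. [cite: Pawlucki2024, Prop. 2.5] -/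
structure SA (F : LensFamilies m q) : Prop where
  D_sa : IsSemialgebraic ℝ F.D
  a_sa : IsSemialgebraicFunOn ℝ univ F.a
  b_sa : IsSemialgebraicFunOn ℝ univ F.b
  bm_sa : ∀ i, IsSemialgebraicFunOn ℝ univ (F.bm i)
  bp_sa : ∀ i, IsSemialgebraicFunOn ℝ univ (F.bp i)
  tm_sa : ∀ i, IsSemialgebraicFunOn ℝ univ (F.tm i)
  tp_sa : ∀ i, IsSemialgebraicFunOn ℝ univ (F.tp i)

variable (S : F.SA)
include S

omit H in
/-- The cuts are semialgebraic. [cite: Pawlucki2024, Prop. 2.5] -/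
theorem cuts_sa (j : Fin F.N) : IsSemialgebraicFunOn ℝ univ (F.cuts j) := by
  refine Fin.addCases (fun i => ?_) (fun i => ?_) j
  · refine Fin.addCases (fun i => ?_) (fun i => ?_) i
    · simp only [cuts, Fin.append_left]; exact S.bm_sa i
    · simp only [cuts, Fin.append_left, Fin.append_right]; exact S.bp_sa i
  · refine Fin.addCases (fun i => ?_) (fun i => ?_) i
    · simp only [cuts, Fin.append_right, Fin.append_left]; exact S.tm_sa i
    · simp only [cuts, Fin.append_right]; exact S.tp_sa i

omit H in
/-- `α k` is semialgebraic on `D`. [cite: Pawlucki2024, Cor. 2.4] -/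
theorem α_sa (k : ℕ) : IsSemialgebraicFunOn ℝ F.D (F.α k) :=
  isSemialgebraicFunOn_rcLaminar S.D_sa (S.a_sa.mono (subset_univ _) S.D_sa) (S.b_sa.mono (subset_univ _) S.D_sa)
    (fun j => (cuts_sa S j).mono (subset_univ _) S.D_sa) k

omit H S in
/-- Non-strict inequalities between semialgebraic functions on a semialgebraic set define
semialgebraic sets. [cite: BochnakCosteRoy1998, §2.2] -/
theorem sa_sep_le {O : Set (Fin m → ℝ)} {f g : (Fin m → ℝ) → ℝ} (hf : IsSemialgebraicFunOn ℝ O f)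
    (hg : IsSemialgebraicFunOn ℝ O g) : IsSemialgebraic ℝ {x | x ∈ O ∧ f x ≤ g x} := by
  have h := (IsSemialgebraicFunOn.sub_holds hg hf).isSemialgebraic_sep_snoc_mem tarski_seidenberg_real_holds
    (T := {z : Fin (m + 1) → ℝ | 0 ≤ z (Fin.last m)}) (sa_const_le _ _)
  convert h using 1
  ext x
  simp only [mem_setOf_eq, Fin.snoc_last, Pi.sub_apply, sub_nonneg]

omit H S in
/-- Strict version. [cite: BochnakCosteRoy1998, §2.2] -/
theorem sa_sep_lt' {O : Set (Fin m → ℝ)} {f g : (Fin m → ℝ) → ℝ} (hf : IsSemialgebraicFunOn ℝ O f)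
    (hg : IsSemialgebraicFunOn ℝ O g) : IsSemialgebraic ℝ {x | x ∈ O ∧ f x < g x} := by
  have h := (IsSemialgebraicFunOn.sub_holds hg hf).isSemialgebraic_sep_snoc_mem tarski_seidenberg_real_holds
    (T := {z : Fin (m + 1) → ℝ | 0 < z (Fin.last m)}) (sa_const_lt _ _)
  convert h using 1
  ext x
  simp only [mem_setOf_eq, Fin.snoc_last, Pi.sub_apply, sub_pos]

omit H in
/-- The covered locus (within `D`) is semialgebraic. [cite: Pawlucki2024, p. 3871] -/
theorem covered_sa (k : ℕ) : IsSemialgebraic ℝ {x | x ∈ F.D ∧ F.Covered k x} := by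
  classical
  have hD := S.D_sa
  have hαk := α_sa S k
  have hαk1 := α_sa S (k + 1)
  have hu : ∀ {f : (Fin m → ℝ) → ℝ}, IsSemialgebraicFunOn ℝ univ f → IsSemialgebraicFunOn ℝ F.D f :=
    fun hf => hf.mono (subset_univ _) hD
  have h1 : IsSemialgebraic ℝ (⋃ i ∈ (Finset.univ : Finset (Fin F.Ib)),
      ({x | x ∈ F.D ∧ F.bm i x ≤ F.α k x} ∩ {x | x ∈ F.D ∧ F.α (k + 1) x ≤ F.bp i x})) :=
    IsSemialgebraic.biUnion _ _ fun i _ => (sa_sep_le (hu (S.bm_sa i)) hαk).inter (sa_sep_le hαk1 (hu (S.bp_sa i)))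
  have h2 : IsSemialgebraic ℝ (⋃ i ∈ (Finset.univ : Finset (Fin F.It)),
      ({x | x ∈ F.D ∧ F.tm i x ≤ F.α k x} ∩ {x | x ∈ F.D ∧ F.α (k + 1) x ≤ F.tp i x})) :=
    IsSemialgebraic.biUnion _ _ fun i _ => (sa_sep_le (hu (S.tm_sa i)) hαk).inter (sa_sep_le hαk1 (hu (S.tp_sa i)))
  convert h1.union h2 using 1
  ext x
  simp only [Covered, mem_setOf_eq, mem_union, mem_iUnion, Finset.mem_univ, exists_true_left, mem_inter_iff]
  constructor
  · rintro ⟨hxD, ⟨i, h1, h2⟩ | ⟨i, h1, h2⟩⟩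
    · exact Or.inl ⟨i, ⟨hxD, h1⟩, hxD, h2⟩
    · exact Or.inr ⟨i, ⟨hxD, h1⟩, hxD, h2⟩
  · rintro (⟨i, ⟨hxD, h1⟩, -, h2⟩ | ⟨i, ⟨hxD, h1⟩, -, h2⟩)
    · exact ⟨hxD, Or.inl ⟨i, h1, h2⟩⟩
    · exact ⟨hxD, Or.inr ⟨i, h1, h2⟩⟩

omit H in
/-- **The free locus is semialgebraic.** [cite: Pawlucki2024, p. 3871] -/
theorem free_sa (k : ℕ) : IsSemialgebraic ℝ (F.Free k) := by
  have h := (sa_sep_lt' (α_sa S k) (α_sa S (k + 1))).diff (covered_sa S k)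
  convert h using 1
  ext x
  simp only [Free, mem_setOf_eq, Set.mem_sdiff]
  tauto

end LensFamilies

end Free

end Literature.ModelTheory.ExponentialFields
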